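import Literature.AlgebraicGeometry.Frobenioids.Prop53Sub
import Literature.AlgebraicGeometry.Frobenioids.RealificationMonoidOn
import Literature.AlgebraicGeometry.Frobenioids.Prop53SubPullbacksReflectHolds
import Literature.AlgebraicGeometry.Frobenioids.ArithmeticFrobenioidHypotheses
import Literature.AlgebraicGeometry.Frobenioids.ArithmeticFrobenioidRealificationDivSlim
import HarnessLib

/-!
# Frobenioids I, Prop. 5.3 at Example 6.3: the rows of the Prop. 5.3 sub-DAG at THE arithmetic Frobenioid, for
# every perf-factoriality witness (row (H); `C_{K/F}^rlf` IS a Frobenioid) — PROOFS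

Mochizuki, *The geometry of Frobenioids I: the general theory*, Kyushu J. Math. **62** (2008) 293–400.
Prop. 5.3, kurims p. 103 ll. 9–16: "Suppose that `Φ` is perf-factorial. Then we shall refer to as the
realification `C^rlf` of the Frobenioid `C` the model Frobenioid [cf. Theorem 5.2, (ii)] associated to the
divisor monoid `Φ^rlf` … and the rational function monoid `ℝ · Φ^birat ⊆ (Φ^rlf)^gp`"
[cite: MochizukiFrdI2008, Prop. 5.3 p.103]; Thm. 6.4 (i), p. 114: "`C^pf`, `C^rlf`, `C^un-tr`, `(C^pf)^un-tr`
are … Frobenioids" and p. 115 l. 20–21 "`D` is Div-slim relative to `Φ`, hence also relative to `Φ^pf`,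
`Φ^rlf`" [cite: MochizukiFrdI2008, Thm. 6.4 (i) p.114].

PROOF-ONLY (theorems, no `def`; cell abc-iut, seat abc-iut-L6-t10 gen 3 = holder of the [FrdI] §6
sub-DAG; L1-lead R89 (1)(r3) / R91 (1d): "the instance-level «`IsMonoidOn Φ^rlf`» at THE arithmetic
Frobenioid").  After FINDING P53-F1 (seat abc-iut-L1-d2: "`Φ` a monoid on `D` ⇒ `Φ^rlf` a monoid on `D`"
is FALSE in general, witness `ℕ² → ℝ_{≥0}`, `(a, b) ↦ a + b√2`), seat abc-iut-w5-d137's statements file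
`Prop53Sub.lean` records the hypotheses of Thm. 5.2 for the realified data as the structure
`FrdI.Prop53Sub.RlfHypotheses` and reduces it (`rlfHypotheses_of`) to named rows; this file DISCHARGES
every row at THE arithmetic Frobenioid `C_{K/F}` of Ex. 6.3 (`arithFrobenioid F K`, seat abc-iut-L6-t10):

* `GpSubfunctor.isFSMSurjective_of_isOfFSMType` — generic: over a base category of FSM-type (every
  FSM-morphism an isomorphism) EVERY subfunctor of groups has surjective pull-backs along FSM-morphisms
  (row P53/L02d is automatic for `D = B(G)⁰`, `FinSubextCat.isOfFSMType`; cf. seat abc-iut-w5-d137's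
  `isFSMSurjective_of_isIso`, the same with the hypothesis unbundled);
* the rows of `Prop53Sub.lean` at THE arithmetic data, for EVERY perf-factoriality witness `hΦ`:
  `arithDivisorFunctor_isMonoidOnRlf` (L02a; the instance `IsMonoidOn Φ^rlf` itself is seat abc-iut-L6-t10 gen 2's
  `arithRlfFunctor_isMonoidOn`, the reflection input its `pullbacksReflectDvd_arith`), `arithDivisorFunctor_rlfDivisorial`
  (L02b), `arithFrobenioid_isMonoidOnRealSpan` (L02c), `arithFrobenioid_realSpanGroupLike` (L02c′),
  `arithFrobenioid_biratFSMSurjective` (L02d);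
* `arith_rlfHypotheses : ∀ hΦ, FrdI.Prop53Sub.RlfHypotheses (C_{K/F} → F_Φ) hΦ` — row (H) for every witness `hΦ`
  (seat abc-iut-w5-d137's `arithFrobenioid_rlfHypotheses` is the instance at one witness), whence
  `arithFrobenioid_rlf_isOfIsotropicType` and `arithFrobenioid_rlf_isFrobenioid'`: **THE realification
  `C_{K/F}^rlf` IS a Frobenioid, of isotropic type, for every `hΦ`** (Thm. 5.2 (ii) at the realified data,
  `rlf_isFrobenioid_of_hypotheses`) — the `C^rlf` clause of Thm. 6.4 (i) for THE constructed `C_{K/F}` (the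
  one-witness `∧`-form is seat abc-iut-w5-d137's `arithFrobenioid_rlf_isFrobenioid`, `Prop53SubRlfIsFrobenioid.lean`;
  cell ruling R105c: first-stamp record, tree wins on bytes).

Standard axioms only. Nothing here bears on [IUTchIII] Cor. 3.12 or asserts anything about abc
(L1 = [FrdI], a refereed preparatory paper).
-/

noncomputable section

namespace Literature.AlgebraicGeometry.Frobenioids

open CategoryTheory Opposite Function Literature.AnabelianGeometry.EtaleTheta

universe w v u

/-! ### P53/L02d is automatic over a base of FSM-type -/

namespace GpSubfunctor

variable {D : Type u} [Category.{v} D] {Φ : Dᵒᵖ ⥤ CommMonCat.{w}}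

/-- Over a base category `D` of FSM-type (every FSM-morphism is an isomorphism, [FrdI] §0), every subfunctor
of groups `Ψ ⊆ Φ^gp` has SURJECTIVE pull-backs along FSM-morphisms: pull back along the inverse.
[cite: MochizukiFrdI2008, Thm. 5.2 p.100] -/
theorem isFSMSurjective_of_isOfFSMType (hD : IsOfFSMType D) (Ψ : GpSubfunctor Φ) : Ψ.IsFSMSurjective := by
  intro X Y f hf c hc
  haveI := hD.isIso_of_isFSM f hf
  refine ⟨pullGp Φ (inv f) c, Ψ.pull_mem (inv f) hc, ?_⟩
  rw [← pullGp_comp, IsIso.hom_inv_id, pullGp_id]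

end GpSubfunctor

section Arith

variable (F : Type) [Field F] [NumberField F] (K : Type) [Field K] [Algebra F K]

variable [IsGalois F K]

omit [IsGalois F K] in
/-- The slot `FrdI.Prop53Sub.IsMonoidOnRlf` (row P53/L02a) at the arithmetic `Φ` (for any monoid-on-`D` and
reflection witnesses). [cite: MochizukiFrdI2008, Prop. 5.3 p.103] -/
theorem arithDivisorFunctor_isMonoidOnRlf
    (hΦ : ∀ X : (FinSubextCat F K)ᵒᵖ, IsPerfFactorial ((arithDivisorFunctor F K).obj X)) :
    FrdI.Prop53Sub.IsMonoidOnRlf (arithDivisorFunctor F K) hΦ :=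
  fun hM hrefl => isMonoidOn_rlfFunctor_of_reflects hΦ hM hrefl

omit [IsGalois F K] in
/-- The slot `FrdI.Prop53Sub.RlfDivisorial` (row P53/L02b) at the arithmetic `Φ`: `Φ^rlf(L)` is divisorial
(`IsPerfFactorial.Rlf.isDivisorial`, Def. 2.4 (i)). [cite: MochizukiFrdI2008, Def. 2.4 (i) p.48] -/
theorem arithDivisorFunctor_rlfDivisorial
    (hΦ : ∀ X : (FinSubextCat F K)ᵒᵖ, IsPerfFactorial ((arithDivisorFunctor F K).obj X)) :
    FrdI.Prop53Sub.RlfDivisorial (arithDivisorFunctor F K) hΦ :=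
  fun X => IsPerfFactorial.Rlf.isDivisorial (hΦ (op X))

/-- The slot `FrdI.Prop53Sub.BiratFSMSurjective` (row P53/L02d) at THE arithmetic Frobenioid `C_{K/F}`:
`Φ^birat` has surjective pull-backs along FSM-morphisms — automatic, `D = B(Gal(K/F))⁰` being of FSM-type.
[cite: MochizukiFrdI2008, Prop. 5.3 p.103] -/
theorem arithFrobenioid_biratFSMSurjective :
    FrdI.Prop53Sub.BiratFSMSurjective
      (ModelFrobenioid.toElem (arithDivisorFunctor F K) (unitsFunctor F K) (divNatTrans F K)) :=
  GpSubfunctor.isFSMSurjective_of_isOfFSMType (FinSubextCat.isOfFSMType F K) _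

omit [IsGalois F K] in
/-- The slot `FrdI.Prop53Sub.IsMonoidOnRealSpan` (row P53/L02c) at THE data of `C_{K/F}` (seat
abc-iut-w5-d137's generic `RealificationData.isMonoidOn_realSpan`). [cite: MochizukiFrdI2008, Prop. 5.3 p.103] -/
theorem arithFrobenioid_isMonoidOnRealSpan
    (hΦ : ∀ X : (FinSubextCat F K)ᵒᵖ, IsPerfFactorial ((arithDivisorFunctor F K).obj X))
    (Ψ : GpSubfunctor (arithDivisorFunctor F K)) :
    FrdI.Prop53Sub.IsMonoidOnRealSpan (RealificationData.canonical (arithDivisorFunctor F K) hΦ) Ψ :=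
  fun hR hint hΨ => RealificationData.isMonoidOn_realSpan _ Ψ hR hint hΨ

omit [IsGalois F K] in
/-- The slot `FrdI.Prop53Sub.RealSpanGroupLike` (row P53/L02c′) at THE data of `C_{K/F}`: `ℝ · Ψ(L)` is a
subgroup of `(Φ^rlf)^gp(L)`, hence group-like (`isGroupLike_of_commGroup`). [cite: MochizukiFrdI2008, Thm. 5.2 p.100] -/
theorem arithFrobenioid_realSpanGroupLike
    (hΦ : ∀ X : (FinSubextCat F K)ᵒᵖ, IsPerfFactorial ((arithDivisorFunctor F K).obj X))
    (Ψ : GpSubfunctor (arithDivisorFunctor F K)) :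
    FrdI.Prop53Sub.RealSpanGroupLike (RealificationData.canonical (arithDivisorFunctor F K) hΦ) Ψ :=
  fun X => isGroupLike_of_commGroup
    (((RealificationData.canonical (arithDivisorFunctor F K) hΦ).realSpan Ψ).carrier X)

/-- **Row (H) of the Prop. 5.3 sub-DAG at THE arithmetic Frobenioid `C_{K/F}`**: the realified data
`(Φ^rlf, ℝ · Φ^birat ↪ (Φ^rlf)^gp)` satisfy the hypotheses of Thm. 5.2 — `Φ^rlf` a divisorial monoid on
`D`, `ℝ · Φ^birat` a group-like monoid on `D`, `D` connected and totally epimorphic — for every choice `hΦ`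
of the perf-factorial witnesses. [cite: MochizukiFrdI2008, Prop. 5.3 p.103] -/
theorem arith_rlfHypotheses (hΦ : PreFrobenioid.IsPerfFactorialOn (arithDivisorFunctor F K)) :
    FrdI.Prop53Sub.RlfHypotheses
      (ModelFrobenioid.toElem (arithDivisorFunctor F K) (unitsFunctor F K) (divNatTrans F K)) hΦ :=
  FrdI.Prop53Sub.rlfHypotheses_of _ hΦ (arithDivisorFunctor_isMonoidOn F K)
    (pullbacksReflectDvd_arith F K) (FinSubextCat.isGraphConnected F K)
    (FinSubextCat.isTotallyEpimorphic F K) (arithDivisorFunctor_isMonoidOnRlf F K _)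
    (arithDivisorFunctor_rlfDivisorial F K _) (arithFrobenioid_isMonoidOnRealSpan F K _ _)
    (arithFrobenioid_realSpanGroupLike F K _ _) (arithFrobenioid_biratFSMSurjective F K)

/-- **Thm. 6.4 (i), `C^rlf` clause, at THE constructed `C_{K/F}`, for EVERY perf-factoriality witness `hΦ`: THE
realification `C_{K/F}^rlf` (Prop. 5.3, `PreFrobenioid.rlf`) IS a Frobenioid** (Thm. 5.2 (ii) at the realified data,
seat abc-iut-w5-d137's `rlf_isFrobenioid_of_hypotheses`; the one-witness `∧`-form is that seat's
`arithFrobenioid_rlf_isFrobenioid`). [cite: MochizukiFrdI2008, Thm. 6.4 (i) p.114] -/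
theorem arithFrobenioid_rlf_isFrobenioid' (hΦ : PreFrobenioid.IsPerfFactorialOn (arithDivisorFunctor F K)) :
    PreFrobenioid.IsFrobenioid
      (PreFrobenioid.rlfToElem
        (ModelFrobenioid.toElem (arithDivisorFunctor F K) (unitsFunctor F K) (divNatTrans F K)) hΦ) :=
  (FrdI.Prop53Sub.rlf_isFrobenioid_of_hypotheses _ hΦ (arith_rlfHypotheses F K hΦ)).1

/-- **Thm. 6.4 (i), `C^rlf` clause, at THE constructed `C_{K/F}`: `C_{K/F}^rlf` is of isotropic type**, for every
witness `hΦ`. [cite: MochizukiFrdI2008, Thm. 6.4 (i) p.114] -/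
theorem arithFrobenioid_rlf_isOfIsotropicType
    (hΦ : PreFrobenioid.IsPerfFactorialOn (arithDivisorFunctor F K)) :
    PreFrobenioid.IsOfIsotropicType
      (PreFrobenioid.rlfToElem
        (ModelFrobenioid.toElem (arithDivisorFunctor F K) (unitsFunctor F K) (divNatTrans F K)) hΦ) :=
  (FrdI.Prop53Sub.rlf_isFrobenioid_of_hypotheses _ hΦ (arith_rlfHypotheses F K hΦ)).2

end Arith

end Literature.AlgebraicGeometry.Frobenioids

end
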